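import Literature.AlgebraicGeometry.Modules.PushforwardFiniteLocallyFree
import Literature.AlgebraicGeometry.Modules.KernelFiniteLocallyFree
import Literature.AlgebraicGeometry.Modules.RankOneCocycle
import Mathlib.AlgebraicGeometry.Morphisms.FlatRank
import HarnessLib

/-!
# The rank of `f_* 𝒪_X` for a finite flat morphism: `HasRank (f_* 𝒪_X) n` from `rk f ≡ n`

Topic `AlgebraicGeometry/Modules`; namespace `Literature.AlgebraicGeometry.Modules`.  THEOREMS ONLY (no definition, no
named fact, no instance, no `sorry`).

[GortzWedhorn2020] Def. 12.18 / Prop. 12.19 (pp. 331–332): a morphism `f : X → Y` is finite locally free iff it is affine and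
`f_* 𝒪_X` is a finite locally free `𝒪_Y`-module; «finite locally free of rank (degree) `n`» when `f_* 𝒪_X` is locally free
of rank `n`; Prop. 12.13 (p. 330): direct images along finite locally free morphisms; Cor. 7.42 (p. 198): vector bundles
on an affine scheme ↔ finite projective modules.  [StacksProject] Tag 02KA: the degree of a finite locally free morphism,
locally constant on the target.  Mathlib formalises the rank POINTWISE as `Scheme.Hom.finrank f y` (`Morphisms/FlatRank`:
over an affine open `Spec A ⊆ Y` with `f⁻¹ = Spec B`, the rank `Module.rankAtStalk B 𝔭_y` of the finite flat `A`-module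
`B`), and lists «relate `Hom.finrank f y` to the rank of `f_* 𝒪_X`» as a TODO; the tree formalises constant-rank vector
bundles as `Motives.HasRank E n` and proves `f_* F` finite locally free for `f` finite flat (★
`Modules/PushforwardFiniteLocallyFree`).  This file is the DICTIONARY between the two:

* §1 **`finrank_eq_rankAtStalk_of_isAffineOpen (f) [IsFinite f] [Flat f] (hV : IsAffineOpen V) (y : V) :
  f.finrank y = Module.rankAtStalk Γ(X, f⁻¹V) (hV.primeIdealOf y)`** (the `Γ(Y, V)`-algebra structure being `f^*_V`):
  the square `Spec Γ(X, f⁻¹V) → X`, `Spec Γ(Y, V) → Y` is cartesian (Mathlib `IsOpenImmersion.isPullback`, `f` affine),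
  so the rank of `f` at `y` is the rank of `Spec (f^*_V)` at `𝔭_y` (Mathlib `Scheme.Hom.finrank_of_isPullback`,
  `finrank_SpecMap_eq_finrank`);
* §2 `natCard_eq_rankAtStalk_of_basis_localizedModule_away` — for a finite flat module `M` over `A` and a basis `ι` of a
  localisation `M_r` over `A_r` with `r ∉ 𝔭`, `#ι = rk_𝔭 M` (Mathlib `Module.rankAtStalk_isBaseChange`,
  `rankAtStalk_eq_finrank_of_free`); and the HEAD **`hasRank_pushforward_unit_of_finrank_eq (f) [IsFinite f] [Flat f]
  [IsLocallyNoetherian Y] (n) (h : ∀ y, f.finrank y = n) : HasRank ((Scheme.Modules.pushforward f).obj (unit _)) n`**: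
  over an affine open `V = Spec A ∋ y`, `M := Γ(f_* 𝒪, V) = Γ(X, f⁻¹V)` is finite flat, hence finite projective, over the
  noetherian `A` (as in ★ `IsFiniteLocallyFree.pushforward_of_isFinite_of_flat`); a basis of `M_r`, `r ∉ 𝔭_y` (★
  `exists_basis_localizedModule_away`), frames the affine-localizing module `f_* 𝒪` (★
  `isAffineLocalizing_pushforward_of_isAffineHom`) on `D(r)` (★ `nonempty_basis_sections_basicOpen`, ★
  `nonempty_free_iso_over_of_basis`), and its size is `rk_{𝔭_y} M = rk_y f = n` (§1, §2); these frames are a `FrameSystem`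
  of constant rank `n` (★ `FrameSystem.hasRank`, `Modules/RankOneCocycle`).

Cell `hodgecm-mathlib` (D-0151), (D2-dict): with ★-pending `AbelianSchemes/PolarizationLamFinrank`
(`Polarization.finrank_lam_left_eq_of_hasType`: a polarisation of type `δ` has `rk λ ≡ (∏ δᵢ)²`) it yields the owed D2 leaf
`Polarization.HasType δ → Polarization.HasDegree (polarizationDegree δ)` ([MumfordFogartyKirwan1994] Def. 7.2 (ii) «`ϖ_*(o_X)`
locally free of rank `d²`») over locally noetherian `ℚ`-bases; and it is the F-1 (c) dictionary of the cell's F-DAG price sheet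
(«`[N]` finite locally free of degree `N^{2g}`», with ★ `AbelianSchemeOverMulNEtale.finrank_pow_id_left`).  COUNT-NEUTRAL
capital: HC_CM is proved only modulo the 7 printed citations until rung 0 closes; this file discharges none of them.

## References
* [GortzWedhorn2020] U. Görtz, T. Wedhorn, *Algebraic Geometry I: Schemes*, 2nd ed. (2020), Cor. 7.42 (p. 198), Prop. 12.13
  (p. 330), Def. 12.18 and Prop. 12.19 (pp. 331–332).
* [StacksProject] The Stacks Project, Tag 02KA.
* [MumfordFogartyKirwan1994] D. Mumford, J. Fogarty, F. Kirwan, *Geometric Invariant Theory*, 3rd ed. (1994), Ch. 7 §2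
  Definition 7.2 (p. 129).
-/

set_option autoImplicit false

noncomputable section

universe u

open CategoryTheory CategoryTheory.Limits AlgebraicGeometry TopologicalSpace Opposite
open Literature.AlgebraicGeometry.Motives

namespace Literature.AlgebraicGeometry.Modules

variable {X Y : Scheme.{u}} (f : X ⟶ Y)

/-! ### §1 The rank of a finite flat morphism over an affine open is the stalk rank of the algebra of sections -/

/-- **`rk_y f = rk_𝔭 Γ(X, f⁻¹V)` over an affine open `V ∋ y`**: for `f` finite and flat and `V ⊆ Y` affine open, Mathlib's
rank `Scheme.Hom.finrank f y` at `y ∈ V` is the rank at the prime `𝔭_y ⊂ Γ(Y, V)` of the finite flat `Γ(Y, V)`-algebra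
`Γ(X, f⁻¹V)` (Mathlib `Module.rankAtStalk`): the square `Spec Γ(X, f⁻¹V) → X`, `Spec Γ(Y, V) → Y` is cartesian (`f` affine;
Mathlib `IsOpenImmersion.isPullback`), so `rk_y f = rk (Spec (f^*_V))` (Mathlib `finrank_of_isPullback`,
`finrank_SpecMap_eq_finrank`). [cite: StacksProject, Tag 02KA] [cite: GortzWedhorn2020, Def. 12.18 and Prop. 12.19 (pp. 331–332)] -/
theorem finrank_eq_rankAtStalk_of_isAffineOpen [IsFinite f] [Flat f] {V : Y.Opens} (hV : IsAffineOpen V) (y : V) :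
    letI := (f.app V).hom.toAlgebra
    f.finrank y.1 = Module.rankAtStalk (R := Γ(Y, V)) Γ(X, f ⁻¹ᵁ V) (hV.primeIdealOf y) := by
  have hsq : IsPullback (Spec.map (f.app V)) (hV.preimage f).fromSpec hV.fromSpec f := by
    refine IsOpenImmersion.isPullback _ _ _ _ ?_ ?_
    · rw [Scheme.Hom.app_eq_appLE]
      exact (IsAffineOpen.SpecMap_appLE_fromSpec f hV (hV.preimage f) le_rfl).symm
    · rw [IsAffineOpen.opensRange_fromSpec, IsAffineOpen.opensRange_fromSpec]
  have h1 := Scheme.Hom.finrank_of_isPullback _ _ _ _ hsq.flip (hV.primeIdealOf y)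
  rw [IsAffineOpen.fromSpec_primeIdealOf] at h1
  rw [← h1]
  have hfin : (f.app V).hom.Finite := f.finite_app V hV
  have hflat : (f.app V).hom.Flat := by
    have h := f.flat_appLE hV (hV.preimage f) le_rfl
    rw [← Scheme.Hom.app_eq_appLE] at h
    exact h
  rw [Scheme.Hom.finrank_SpecMap_eq_finrank hfin hflat]
  rfl

/-! ### §2 A frame of the right size at every point -/

/-- **The rank of `Γ(X, f⁻¹V)` at `𝔭_y` is the size of any basis of a localisation `Γ(X, f⁻¹V)_r`, `r ∉ 𝔭_y`** (finite flat
modules: the stalk rank is computed after any base change to a localisation, Mathlib `Module.rankAtStalk_isBaseChange`,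
`rankAtStalk_eq_finrank_of_free`). [cite: GortzWedhorn2020, Cor. 7.42 (p. 198)] -/
theorem natCard_eq_rankAtStalk_of_basis_localizedModule_away {A : Type u} [CommRing A] {M : Type u} [AddCommGroup M]
    [Module A M] [Module.Finite A M] [Module.Flat A M] (𝔭 : PrimeSpectrum A) {r : A} (hr : r ∉ 𝔭.asIdeal) {ι : Type u}
    [Finite ι] (b : Module.Basis ι (Localization (.powers r)) (LocalizedModule.Away r M)) :
    Nat.card ι = Module.rankAtStalk M 𝔭 := by
  -- a prime `𝔭′` of `A_r` over `𝔭` (it exists since `r ∉ 𝔭`)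
  have hmem : 𝔭 ∈ Set.range (PrimeSpectrum.comap (algebraMap A (Localization (.powers r)))) := by
    rw [PrimeSpectrum.localization_away_comap_range (Localization (.powers r)) r]
    exact hr
  obtain ⟨𝔭', h𝔭'⟩ := hmem
  have hbc := IsLocalizedModule.isBaseChange (.powers r) (Localization (.powers r))
    (LocalizedModule.mkLinearMap (.powers r) M)
  have h1 := Module.rankAtStalk_isBaseChange hbc 𝔭'
  rw [h𝔭'] at h1
  rw [← h1]
  haveI : Nontrivial (Localization (.powers r)) := PrimeSpectrum.nonempty_iff_nontrivial.mp ⟨𝔭'⟩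
  haveI : Module.Free (Localization (.powers r)) (LocalizedModule.Away r M) := Module.Free.of_basis b
  rw [Module.rankAtStalk_eq_finrank_of_free, Pi.natCast_apply]
  exact (Module.finrank_eq_nat_card_basis b).symm

/-- **`HasRank (f_* 𝒪_X) n` for a finite flat morphism of constant rank `n`** — the dictionary between Mathlib's
`Scheme.Hom.finrank` (rank of a finite flat morphism at a point; `Morphisms/FlatRank`, whose TODO list names «relate
`Hom.finrank f y` to the rank of `f_* 𝒪_X`») and the tree's `HasRank` (constant-rank vector bundles): for `f : X → Y` finite
and flat with `Y` locally noetherian and `rk_y f = n` for all `y`, the direct image `f_* 𝒪_X` is locally free of rank `n`.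
Proof: over an affine open `V = Spec A ∋ y`, `M := Γ(f_*𝒪, V) = Γ(X, f⁻¹V)` is finite flat, hence finite projective, over
the noetherian `A` (as in ★ `IsFiniteLocallyFree.pushforward_of_isFinite_of_flat`); a basis of `M_r` over `A_r` for some
`r ∉ 𝔭_y` (★ `exists_basis_localizedModule_away`) frames `f_*𝒪` on `D(r)` (★ `nonempty_basis_sections_basicOpen`,
★ `nonempty_free_iso_over_of_basis`; `f_*𝒪` is affine-localizing, ★ `isAffineLocalizing_pushforward_of_isAffineHom`), and
its size is `rk_{𝔭_y} M = rk_y f = n` (§1, §2); these frames form a `FrameSystem` of constant rank `n` (★ `FrameSystem.hasRank`).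
[cite: GortzWedhorn2020, Prop. 12.13 (p. 330) with Def. 12.18 and Prop. 12.19 (pp. 331–332)] [cite: StacksProject, Tag 02KA] -/
theorem hasRank_pushforward_unit_of_finrank_eq [IsFinite f] [Flat f] [IsLocallyNoetherian Y] (n : ℕ)
    (h : ∀ y : Y, f.finrank y = n) :
    HasRank ((Scheme.Modules.pushforward f).obj (SheafOfModules.unit _)) n := by
  classical
  -- notation
  let E : Y.Modules := (Scheme.Modules.pushforward f).obj (SheafOfModules.unit _)
  have hloc : IsAffineLocalizing E := isAffineLocalizing_pushforward_of_isAffineHom f IsAffineLocalizing.unit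
  -- at every point: an affine open, a localisation with a basis, a frame on a basic open of size `n`
  have key : ∀ y : Y, ∃ (U : Y.Opens) (_ : y ∈ U) (ι : Type u) (_ : Finite ι) (_ : Nat.card ι = n),
      Nonempty (SheafOfModules.free ι ≅ E.over U) := by
    intro y
    obtain ⟨_, ⟨V, hV, rfl⟩, hyV, -⟩ :=
      Y.isBasis_affineOpens.exists_subset_of_mem_open (Set.mem_univ y) isOpen_univ
    letI : Algebra Γ(Y, V) Γ(X, f ⁻¹ᵁ V) := (f.app V).hom.toAlgebra
    haveI : IsNoetherianRing Γ(Y, V) := IsLocallyNoetherian.component_noetherian ⟨V, hV⟩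
    haveI hfin : Module.Finite Γ(Y, V) Γ(X, f ⁻¹ᵁ V) := f.finite_app V hV
    haveI hflat : Module.Flat Γ(Y, V) Γ(X, f ⁻¹ᵁ V) := by
      have h := f.flat_appLE hV (hV.preimage f) le_rfl
      rw [← Scheme.Hom.app_eq_appLE] at h
      exact h
    haveI : Module.FinitePresentation Γ(Y, V) Γ(X, f ⁻¹ᵁ V) :=
      Module.finitePresentation_of_finite Γ(Y, V) Γ(X, f ⁻¹ᵁ V)
    haveI : Module.Projective Γ(Y, V) Γ(X, f ⁻¹ᵁ V) := Module.Flat.projective_of_finitePresentation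
    -- `Γ(E, V) = Γ(X, f⁻¹V)` with the `Γ(Y, V)`-module structure through `f^*`
    letI : Module Γ(Y, V) Γ(E, V) := Module.compHom Γ(X, f ⁻¹ᵁ V) (f.app V).hom
    haveI : Module.Finite Γ(Y, V) Γ(E, V) := hfin
    haveI : Module.Projective Γ(Y, V) Γ(E, V) := ‹Module.Projective Γ(Y, V) Γ(X, f ⁻¹ᵁ V)›
    haveI : Module.Flat Γ(Y, V) Γ(E, V) := hflat
    obtain ⟨r, hr, ι, hι, ⟨b⟩⟩ :=
      exists_basis_localizedModule_away Γ(E, V) (hV.primeIdealOf ⟨y, hyV⟩).asIdeal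
    obtain ⟨bD⟩ := nonempty_basis_sections_basicOpen hloc hV r b
    obtain ⟨e⟩ := nonempty_free_iso_over_of_basis E hloc (hV.basicOpen r) bD
    refine ⟨Y.basicOpen r, (mem_basicOpen_iff_not_mem_primeIdealOf hV r hyV).mpr hr, ι, hι, ?_, ⟨e⟩⟩
    rw [natCard_eq_rankAtStalk_of_basis_localizedModule_away (hV.primeIdealOf ⟨y, hyV⟩) hr b]
    have e2 := finrank_eq_rankAtStalk_of_isAffineOpen f hV ⟨y, hyV⟩
    rw [h y] at e2
    exact e2.symm
  choose U hU ι hι hcard e using key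
  exact FrameSystem.hasRank
    { U := U
      mem := hU
      I := ι
      rank := fun _ => n
      enum := fun y => haveI := hι y; (Finite.equivFin (ι y)).trans (finCongr (hcard y))
      frame := fun y => (e y).some } n fun _ => rfl

end Literature.AlgebraicGeometry.Modules

end
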